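import Literature.Probability.LatticeModels.ClusteringToTreeBound
import Literature.Probability.LatticeModels.CurrentsSetConditioning
import Mathlib.Data.Nat.Choose.Bounds
import HarnessLib

/-!
# The skeleton of the intersection-clustering bound (Aizenman–Duminil-Copin 2021, proof of Prop. 4.3 / Prop. 6.1)

Topic `Literature/Probability/LatticeModels`. The intersection-clustering bound of

* M. Aizenman, H. Duminil-Copin, *Marginal triviality of the scaling limits of critical 4D Ising and
  `φ⁴₄` models*, Ann. of Math. **194** (2021), arXiv:1912.07973 [AizenmanDuminilCopinAnnals2021],
  **Proposition 6.1** (clustering bound, p. 21; conditional version **Proposition 4.3**, p. 10):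
  "`P^{ux,uz,uy,ut}_β[𝐌_u(𝒯; 𝓛, K) < δK] ≤ 2^{-δK}`",

is proved (pp. 14–15, and "exactly identical" on p. 22) in four moves, of which this file formalises
the three that are not the mixing/intersection properties themselves:

1. **(counting)** "observe that if `𝐌_0(𝒯; 𝓛_α, K) ≤ δK`, then there must exist a set `S ∈ 𝒮_K`
   of cardinality at least `(½ - δ)K` such that `B_S` occurs", `B_S` = "the clusters of `0` in
   `n₁+n₃` and `n₂+n₄` do not intersect in any of the annuli `Ann(ℓ_s, ℓ_{s+1})` for `s ∈ S`", and
   the union bound "`P[𝐌_0 < δK] ≤ ∑_{S ∈ 𝒮_K : |S| ≥ (½-δ)K} P[B_S]`" — here for an arbitrary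
   finite set `E` of usable indices (the printed `𝒮_K` = even integers in `{1,…,K-3}`) and at the
   exact cardinality `|E| + 1 - m` (`B_S` is monotone in `S`), in the un-normalised current-sum
   setting of the tree's `Current.clusteringMass` (`ClusteringToTreeBound.lean`):
   `clusteringMass ≤ ∑_{S ⊆ E, |S| = |E|+1-m} fourAvoidMass(… annuli(S))`
   (`Current.clusteringMass_le_sum_fourAvoidMass`);
2. **(removing sources)** "Thanks to Corollary A.2, the probability of `B_S` increases when removing
   sources, so that `P^{0x,0z,0y,0t}[B_S] ≤ P^{0x,0z,∅,∅}[B_S]`" — the tree's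
   `Current.fourAvoidMass_mul_sq_le_left` (`CurrentsSetConditioning.lean`) summed over `S`
   (`Current.clusteringMass_mul_sq_le_sum`), together with the within-pair symmetry
   `clusteringMass … x y z t u = clusteringMass … y x t z u` behind "Without loss of generality we
   take that to be `x`, and make a similar assumption about `z`" (`Current.clusteringMass_swap`);
3. **(induction)** "`P[A_S] ≤ (1-2c₀) P[A_{S∖{s}}] + c₀(1-c₀)^{|S|-1}`. An induction gives immediately
   that for every `S ∈ 𝒮_K`, `P[A_S] ≤ (1-c₀)^{|S|}`" (`le_pow_card_of_erase_max_step`, for an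
   arbitrary real set function, `s = max S`);
4. **(numerics)** "`≤ binom(K/2, δK) (1-c₀)^{(½-δ)K}`, which implies the claim by appropriately
   choosing the value of `δ`" — for every `0 < q < 1` an explicit `δ = δ(q) > 0` with
   `binom(n, j) q^{n-j} ≤ e^{-δK}` whenever `K ≥ 8`, `K/2 - 2 ≤ n ≤ K`, `j ≤ δK`
   (`exists_delta_choose_mul_pow_le_exp_neg`), by `binom(n,j) ≤ (en/j)^j` and `log x ≤ x - 1`.

The two probabilistic inputs — the intersection property (Lemma 4.4 / 6.2, `P[I_k] ≥ c`) and the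
mixing property (Prop. 4.6 / Thm 6.4) — and the inclusion `B_S ⊆ A_S` are not part of this file;
nor is any named fact introduced: everything here is proved (finite volume, general couplings
`K ≥ 0`, vertex type carrying a pseudo-metric as in `ClusteringToTreeBound.lean`).

## References

* M. Aizenman, H. Duminil-Copin, Ann. of Math. 194 (2021), arXiv:1912.07973, §4.2, proof of
  Prop. 4.3 (pp. 14–15); §6.1, Prop. 6.1 and its proof (pp. 21–22); Appendix A, Cor. A.2
  [AizenmanDuminilCopinAnnals2021].

## Mathlib

`Finset.powersetCard`, `Finset.card_powersetCard`, `Finset.exists_subset_card_eq`,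
`Finset.card_filter_add_card_filter_not`, `Nat.choose_le_pow_div`,
`Real.pow_div_factorial_le_exp`, `Real.log_le_sub_one_of_pos`, `Real.exp_log`.
-/

noncomputable section

open Finset Filter
open scoped symmDiff ENNReal

namespace Literature.Probability.LatticeModels

/-! ### Part 1. Annuli as vertex sets and the deterministic count -/

section Annuli

variable {α : Type*} [PseudoMetricSpace α] [Fintype α]

open scoped Classical in
/-- The closed annulus `u + Ann(ℓ_k, ℓ_{k+1}) = {x : ℓ_k ≤ dist(u,x) ≤ ℓ_{k+1}}` around `u`, as a finite
set of vertices (Aizenman–Duminil-Copin 2021, §4.1: `Ann(k,n) := Λ_n ∖ Λ_{k-1}`, and the annuli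
`u + Ann(ℓ_k, ℓ_{k+1})` of the definition of `𝐌_u`). [cite: AizenmanDuminilCopinAnnals2021, arXiv:1912.07973 §4.1, definition of M_u before Lemma 4.2 (p. 10)] -/
def annulusFinset (ℓ : ℕ → ℕ) (u : α) (k : ℕ) : Finset α :=
  univ.filter fun x => (ℓ k : ℝ) ≤ dist u x ∧ dist u x ≤ ℓ (k + 1)

/-- Membership in the annulus. [folklore] -/
theorem mem_annulusFinset_iff {ℓ : ℕ → ℕ} {u x : α} {k : ℕ} :
    x ∈ annulusFinset ℓ u k ↔ (ℓ k : ℝ) ≤ dist u x ∧ dist u x ≤ ℓ (k + 1) := by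
  classical
  unfold annulusFinset
  rw [mem_filter]
  simp

/-- Occupation of the `k`-th annulus is non-disjointness from it. [folklore] -/
theorem annulusOccupied_iff_not_disjoint {ℓ : ℕ → ℕ} {X : Finset α} {u : α} {k : ℕ} :
    AnnulusOccupied ℓ X u k ↔ ¬ Disjoint X (annulusFinset ℓ u k) := by
  unfold AnnulusOccupied
  rw [Finset.not_disjoint_iff]
  simp only [mem_annulusFinset_iff]

variable [DecidableEq α]

/-- The union `⋃_{s ∈ S} (u + Ann(ℓ_s, ℓ_{s+1}))` of the annuli with indices in `S` (the set in which
the event `B_S` of Aizenman–Duminil-Copin 2021, proof of Prop. 4.3, forbids intersections).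
[cite: AizenmanDuminilCopinAnnals2021, arXiv:1912.07973 §4.2, proof of Prop. 4.3 (event B_S, p. 14)] -/
def annuliFinset (ℓ : ℕ → ℕ) (u : α) (S : Finset ℕ) : Finset α := S.biUnion (annulusFinset ℓ u)

/-- `X` avoids the annuli of `S` iff no annulus of index in `S` is occupied by `X` — the event
`B_S` read on the set `X = 𝒯`. [cite: AizenmanDuminilCopinAnnals2021, arXiv:1912.07973 §4.2, proof of Prop. 4.3 (event B_S, p. 14)] -/
theorem disjoint_annuliFinset_iff {ℓ : ℕ → ℕ} {X : Finset α} {u : α} {S : Finset ℕ} :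
    Disjoint X (annuliFinset ℓ u S) ↔ ∀ k ∈ S, ¬ AnnulusOccupied ℓ X u k := by
  unfold annuliFinset
  rw [Finset.disjoint_biUnion_right]
  refine forall₂_congr fun k _ => ?_
  rw [annulusOccupied_iff_not_disjoint, not_not]

/-- **The counting step** (Aizenman–Duminil-Copin 2021, proof of Prop. 4.3: "if `𝐌_0(𝒯;𝓛,K) ≤ δK`,
then there must exist a set `S ∈ 𝒮_K` of cardinality at least `(½-δ)K` such that `B_S` occurs"):
if fewer than `m` annuli of index `≤ K_s` are occupied and `E ⊆ {0,…,K_s}`, the unoccupied indices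
of `E` form a set `S` with `|E| < |S| + m` all of whose annuli `X` avoids.
[cite: AizenmanDuminilCopinAnnals2021, arXiv:1912.07973 §4.2, proof of Prop. 4.3 (last paragraph, p. 15)] -/
theorem exists_avoid_of_annulusCount_lt {ℓ : ℕ → ℕ} {X : Finset α} {u : α} {Ks m : ℕ} {E : Finset ℕ}
    (hE : E ⊆ range (Ks + 1)) (h : annulusCount ℓ Ks X u < m) :
    ∃ S ⊆ E, #E < #S + m ∧ Disjoint X (annuliFinset ℓ u S) := by
  classical
  refine ⟨E.filter fun k => ¬ AnnulusOccupied ℓ X u k, Finset.filter_subset _ _, ?_, ?_⟩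
  · have hsplit := Finset.card_filter_add_card_filter_not (s := E) (fun k => ¬ AnnulusOccupied ℓ X u k)
    have hocc : #(E.filter fun k => ¬¬ AnnulusOccupied ℓ X u k) ≤ annulusCount ℓ Ks X u := by
      unfold annulusCount
      refine Finset.card_le_card fun k hk => ?_
      rw [mem_filter] at hk ⊢
      exact ⟨hE hk.1, not_not.1 hk.2⟩
    omega
  · rw [disjoint_annuliFinset_iff]
    intro k hk
    exact (mem_filter.1 hk).2

/-- **The counting step at exact cardinality**: under the same hypotheses and `m ≤ |E| + 1`, some
`S ⊆ E` with `|S| = |E| + 1 - m` has all its annuli avoided by `X` (shrink the previous `S`; avoidance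
is monotone in `S`). [cite: AizenmanDuminilCopinAnnals2021, arXiv:1912.07973 §4.2, proof of Prop. 4.3 (last paragraph, p. 15)] -/
theorem exists_avoid_card_eq_of_annulusCount_lt {ℓ : ℕ → ℕ} {X : Finset α} {u : α} {Ks m : ℕ}
    {E : Finset ℕ} (hE : E ⊆ range (Ks + 1)) (h : annulusCount ℓ Ks X u < m) :
    ∃ S ∈ E.powersetCard (#E + 1 - m), Disjoint X (annuliFinset ℓ u S) := by
  obtain ⟨S₀, hS₀E, hcard, hdis⟩ := exists_avoid_of_annulusCount_lt hE h
  obtain ⟨S, hSS₀, hS⟩ := Finset.exists_subset_card_eq (s := S₀) (n := #E + 1 - m) (by omega)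
  refine ⟨S, Finset.mem_powersetCard.2 ⟨hSS₀.trans hS₀E, hS⟩, ?_⟩
  rw [disjoint_annuliFinset_iff] at hdis ⊢
  exact fun k hk => hdis k (hSS₀ hk)

/-- **The union bound, indicator form**: `𝟙[𝐌_u(X) < m] ≤ ∑_{S ⊆ E, |S| = |E|+1-m} 𝟙[X ∩ annuli(S) = ∅]`
in `ℝ≥0∞`. [cite: AizenmanDuminilCopinAnnals2021, arXiv:1912.07973 §4.2, proof of Prop. 4.3 (the display P[M_0 < δK] ≤ ∑_S P[B_S], p. 15)] -/
theorem indicator_annulusCount_lt_le_sum {ℓ : ℕ → ℕ} (X : Finset α) (u : α) {Ks : ℕ} (m : ℕ)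
    {E : Finset ℕ} (hE : E ⊆ range (Ks + 1)) :
    (if annulusCount ℓ Ks X u < m then (1 : ℝ≥0∞) else 0) ≤
      ∑ S ∈ E.powersetCard (#E + 1 - m), (if Disjoint X (annuliFinset ℓ u S) then (1 : ℝ≥0∞) else 0) := by
  by_cases h : annulusCount ℓ Ks X u < m
  · rw [if_pos h]
    obtain ⟨S, hS, hdis⟩ := exists_avoid_card_eq_of_annulusCount_lt hE h
    calc (1 : ℝ≥0∞) = if Disjoint X (annuliFinset ℓ u S) then (1 : ℝ≥0∞) else 0 := by rw [if_pos hdis]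
      _ ≤ ∑ S' ∈ E.powersetCard (#E + 1 - m), (if Disjoint X (annuliFinset ℓ u S') then (1 : ℝ≥0∞) else 0) :=
          Finset.single_le_sum (f := fun S' => if Disjoint X (annuliFinset ℓ u S') then (1 : ℝ≥0∞) else 0)
            (fun _ _ => bot_le) hS
  · rw [if_neg h]; exact bot_le

end Annuli

/-! ### Part 2. The clustering mass: union bound and removal of sources -/

section Mass

variable {V : Type*} [Fintype V] [DecidableEq V] {G : SimpleGraph V} [DecidableRel G.Adj]

namespace Current

variable {K : G.edgeFinset → ℝ}

/-- **Within-pair symmetry of the clustering mass**: exchanging the two currents of each pair,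
`clusteringMass x y z t u = clusteringMass y x t z u` — the relabelling behind "Without loss of
generality we take that to be `x`, and make a similar assumption about `z`" (which of the two sources
of a pair is kept is immaterial). [cite: AizenmanDuminilCopinAnnals2021, arXiv:1912.07973 §4.2, proof of Prop. 4.3 (first paragraph, p. 14)] -/
theorem clusteringMass_swap [PseudoMetricSpace V] (K : G.edgeFinset → ℝ) (ℓ : ℕ → ℕ) (Ks r : ℕ)
    (x y z t u : V) :
    clusteringMass K ℓ Ks r x y z t u = clusteringMass K ℓ Ks r y x t z u := by
  unfold clusteringMass
  rw [← ((Equiv.prodComm (Current G) (Current G)).prodCongr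
    (Equiv.prodComm (Current G) (Current G))).tsum_eq]
  refine tsum_congr fun pq => ?_
  simp only [Equiv.prodCongr_apply, Equiv.prodComm_apply, Prod.map_fst, Prod.map_snd, Prod.fst_swap,
    Prod.snd_swap, epairWeight_swap, add_comm pq.1.2 pq.1.1, add_comm pq.2.2 pq.2.1]

/-- **The union bound for the clustering mass** (Aizenman–Duminil-Copin 2021, proof of Prop. 4.3:
"`P^{0x,0z,0y,0t}[𝐌_0(𝒯; 𝓛_α, K) < δK] ≤ ∑_{S ∈ 𝒮_K : |S| ≥ (½-δ)K} P^{0x,0z,0y,0t}[B_S]`"), un-normalised,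
for any finite set `E ⊆ {0,…,K_s}` of usable indices, at the exact cardinality `|E| + 1 - 7r`:
`clusteringMass ≤ ∑_{S ⊆ E, |S| = |E|+1-7r} M^{uy,ux;ut,uz}[C_{n₁+n₃}(u) ∩ C_{n₂+n₄}(u) ∩ annuli_u(S) = ∅]`.
[cite: AizenmanDuminilCopinAnnals2021, arXiv:1912.07973 §4.2, proof of Prop. 4.3 (p. 15); §6.1 Prop. 6.1] -/
theorem clusteringMass_le_sum_fourAvoidMass [PseudoMetricSpace V] (K : G.edgeFinset → ℝ) (ℓ : ℕ → ℕ)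
    {Ks : ℕ} (r : ℕ) {E : Finset ℕ} (hE : E ⊆ range (Ks + 1)) (x y z t u : V) :
    clusteringMass K ℓ Ks r x y z t u ≤
      ∑ S ∈ E.powersetCard (#E + 1 - 7 * r),
        fourAvoidMass K ({y} ∆ {u}) ({x} ∆ {u}) ({t} ∆ {u}) ({z} ∆ {u}) u (annuliFinset ℓ u S) := by
  unfold clusteringMass fourAvoidMass
  rw [← Summable.tsum_finsetSum (fun _ _ => ENNReal.summable)]
  refine ENNReal.tsum_le_tsum fun pq => ?_
  rw [← Finset.mul_sum]
  refine mul_le_mul' le_rfl ?_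
  exact indicator_annulusCount_lt_le_sum _ u (7 * r) hE

/-- **Removing the sources `y`, `t`** (Aizenman–Duminil-Copin 2021, proof of Prop. 4.3: "Thanks to
Corollary A.2, the probability of `B_S` increases when removing sources, so that
`P^{0x,0z,0y,0t}[B_S] ≤ P^{0x,0z,∅,∅}[B_S]`", summed over `S`): with `Z = ecurrentSum K`,
`clusteringMass · Z[∅]² ≤ Z[{u,y}] Z[{u,t}] · ∑_{S ⊆ E, |S| = |E|+1-7r} M^{∅,ux;∅,uz}[𝒯_u ∩ annuli_u(S) = ∅]`.
(To remove `x`, `z` instead, use `clusteringMass_swap` first.)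
[cite: AizenmanDuminilCopinAnnals2021, arXiv:1912.07973 §4.2, proof of Prop. 4.3 (p. 14–15) with Appendix A, Cor. A.2] -/
theorem clusteringMass_mul_sq_le_sum [PseudoMetricSpace V] (hK : ∀ e, 0 ≤ K e) (ℓ : ℕ → ℕ) {Ks : ℕ}
    (r : ℕ) {E : Finset ℕ} (hE : E ⊆ range (Ks + 1)) (x y z t u : V) :
    clusteringMass K ℓ Ks r x y z t u * ecurrentSum K ∅ ^ 2 ≤
      ecurrentSum K ({u} ∆ {y}) * ecurrentSum K ({u} ∆ {t}) *
        ∑ S ∈ E.powersetCard (#E + 1 - 7 * r),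
          fourAvoidMass K ∅ ({x} ∆ {u}) ∅ ({z} ∆ {u}) u (annuliFinset ℓ u S) := by
  calc clusteringMass K ℓ Ks r x y z t u * ecurrentSum K ∅ ^ 2
      ≤ (∑ S ∈ E.powersetCard (#E + 1 - 7 * r),
          fourAvoidMass K ({y} ∆ {u}) ({x} ∆ {u}) ({t} ∆ {u}) ({z} ∆ {u}) u (annuliFinset ℓ u S)) *
          ecurrentSum K ∅ ^ 2 :=
        mul_le_mul' (clusteringMass_le_sum_fourAvoidMass K ℓ r hE x y z t u) le_rfl
    _ = ∑ S ∈ E.powersetCard (#E + 1 - 7 * r),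
          fourAvoidMass K ({u} ∆ {y}) ({x} ∆ {u}) ({u} ∆ {t}) ({z} ∆ {u}) u (annuliFinset ℓ u S) *
            ecurrentSum K ∅ ^ 2 := by
        rw [Finset.sum_mul]
        simp only [symmDiff_comm ({y} : Finset V) {u}, symmDiff_comm ({t} : Finset V) {u}]
    _ ≤ ∑ S ∈ E.powersetCard (#E + 1 - 7 * r), ecurrentSum K ({u} ∆ {y}) * ecurrentSum K ({u} ∆ {t}) *
          fourAvoidMass K ∅ ({x} ∆ {u}) ∅ ({z} ∆ {u}) u (annuliFinset ℓ u S) :=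
        Finset.sum_le_sum fun S _ => fourAvoidMass_mul_sq_le_left hK _ _ u y t _
    _ = _ := by rw [← Finset.mul_sum]

/-- Bounding a sum over `S ⊆ E` of fixed cardinality `k` by `binom(|E|, k)` times a uniform bound.
[folklore] -/
theorem sum_powersetCard_le_choose_mul {β : Type*} (E : Finset β) (k : ℕ) {f : Finset β → ℝ≥0∞}
    {c : ℝ≥0∞} (h : ∀ S ∈ E.powersetCard k, f S ≤ c) :
    ∑ S ∈ E.powersetCard k, f S ≤ ((#E).choose k : ℝ≥0∞) * c := by
  calc ∑ S ∈ E.powersetCard k, f S ≤ ∑ _S ∈ E.powersetCard k, c := Finset.sum_le_sum h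
    _ = ((#E).choose k : ℝ≥0∞) * c := by rw [sum_const, nsmul_eq_mul, Finset.card_powersetCard]

end Current

end Mass

/-! ### Part 3. The induction `P[A_S] ≤ (1 - c₀)^{|S|}` -/

/-- **The induction of the proof of Prop. 4.3** (Aizenman–Duminil-Copin 2021, p. 14:
"`P[A_S] ≤ (1-2c₀) P[A_{S∖{s}}] + c₀(1-c₀)^{|S|-1}` [with `s` the maximal element of `S`]. An induction
gives immediately that for every `S ∈ 𝒮_K`, `P[A_S] ≤ (1-c₀)^{|S|}`"), for an arbitrary real set
function `P` on the subsets of `E` with `P(∅) ≤ 1` and `c₀ ≤ ½`.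
[cite: AizenmanDuminilCopinAnnals2021, arXiv:1912.07973 §4.2, proof of Prop. 4.3 (the two displays before "Let B_S ⊂ A_S", p. 14)] -/
theorem le_pow_card_of_erase_max_step {E : Finset ℕ} (P : Finset ℕ → ℝ) {c₀ : ℝ}
    (hc : c₀ ≤ 1 / 2) (h0 : P ∅ ≤ 1)
    (hstep : ∀ S ⊆ E, ∀ hS : S.Nonempty,
      P S ≤ (1 - 2 * c₀) * P (S.erase (S.max' hS)) + c₀ * (1 - c₀) ^ (#S - 1)) :
    ∀ S ⊆ E, P S ≤ (1 - c₀) ^ #S := by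
  suffices key : ∀ n : ℕ, ∀ S ⊆ E, #S = n → P S ≤ (1 - c₀) ^ #S from fun S hS => key #S S hS rfl
  intro n
  induction n with
  | zero =>
    intro S _ hS
    rw [Finset.card_eq_zero.1 hS]
    simpa using h0
  | succ n ih =>
    intro S hSE hS
    have hne : S.Nonempty := Finset.card_pos.1 (by omega)
    set S' := S.erase (S.max' hne) with hS'
    have hS'E : S' ⊆ E := (Finset.erase_subset _ _).trans hSE
    have hS'card : #S' = n := by rw [hS', Finset.card_erase_of_mem (Finset.max'_mem S hne)]; omega
    have ih' := ih S' hS'E hS'card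
    rw [hS'card] at ih'
    have h12 : 0 ≤ 1 - 2 * c₀ := by linarith
    calc P S ≤ (1 - 2 * c₀) * P S' + c₀ * (1 - c₀) ^ (#S - 1) := hstep S hSE hne
      _ ≤ (1 - 2 * c₀) * (1 - c₀) ^ n + c₀ * (1 - c₀) ^ (#S - 1) :=
          add_le_add (mul_le_mul_of_nonneg_left ih' h12) le_rfl
      _ = (1 - c₀) ^ #S := by
          rw [hS, show n + 1 - 1 = n by omega, pow_succ]; ring

/-! ### Part 4. The numerics: `binom(n, j) q^{n-j} ≤ e^{-δK}` -/

/-- `binom(n, j) ≤ (e n / j)^j` for `1 ≤ j` (`binom(n,j) ≤ n^j/j!` and `j^j/j! ≤ e^j`). [folklore] -/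
theorem choose_le_exp_mul_div_pow {n j : ℕ} (hj : 1 ≤ j) :
    (n.choose j : ℝ) ≤ (Real.exp 1 * n / j) ^ j := by
  have hj0 : (0 : ℝ) < j := by exact_mod_cast hj
  have h1 : (n.choose j : ℝ) ≤ (n : ℝ) ^ j / (j.factorial : ℝ) := by
    have := Nat.choose_le_pow_div (α := ℝ) j n
    exact_mod_cast this
  have h2 : (j : ℝ) ^ j / (j.factorial : ℝ) ≤ Real.exp 1 ^ j := by
    rw [Real.exp_one_pow]
    exact Real.pow_div_factorial_le_exp (j : ℝ) hj0.le j
  have hfac : (0 : ℝ) < j.factorial := by exact_mod_cast Nat.factorial_pos j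
  calc (n.choose j : ℝ) ≤ (n : ℝ) ^ j / (j.factorial : ℝ) := h1
    _ = (n : ℝ) ^ j / (j : ℝ) ^ j * ((j : ℝ) ^ j / (j.factorial : ℝ)) := by
        field_simp
    _ ≤ (n : ℝ) ^ j / (j : ℝ) ^ j * Real.exp 1 ^ j :=
        mul_le_mul_of_nonneg_left h2 (by positivity)
    _ = (Real.exp 1 * n / j) ^ j := by rw [div_pow, mul_pow]; ring

/-- `log binom(n, j) ≤ Y (1 + log(n/Y))` for `1 ≤ j ≤ Y ≤ n` (`binom ≤ (en/j)^j`, then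
`j log(n/j) = j log(n/Y) + j log(Y/j) ≤ Y log(n/Y) + (Y - j)` by `log x ≤ x - 1`). [folklore] -/
theorem log_choose_le {n j : ℕ} {Y : ℝ} (hj : 1 ≤ j) (hjY : (j : ℝ) ≤ Y) (hYn : Y ≤ n) :
    Real.log (n.choose j : ℝ) ≤ Y * (1 + Real.log (n / Y)) := by
  have hj0 : (0 : ℝ) < j := by exact_mod_cast hj
  have hY0 : 0 < Y := lt_of_lt_of_le hj0 hjY
  have hn0 : (0 : ℝ) < n := lt_of_lt_of_le hY0 hYn
  have hjn : j ≤ n := by exact_mod_cast (hjY.trans hYn)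
  have hpos : (0 : ℝ) < (n.choose j : ℝ) := by exact_mod_cast Nat.choose_pos hjn
  -- `log binom ≤ j (1 + log n - log j)`
  have h1 : Real.log (n.choose j : ℝ) ≤ j * (1 + Real.log (n / j)) := by
    have h := Real.log_le_log hpos (choose_le_exp_mul_div_pow (n := n) hj)
    rw [Real.log_pow, mul_div_assoc, Real.log_mul (Real.exp_pos 1).ne' (by positivity), Real.log_exp] at h
    exact h
  -- `j log(n/j) = j log(n/Y) + j log(Y/j)` and `log(Y/j) ≤ Y/j - 1`
  have h2 : Real.log ((n : ℝ) / j) = Real.log (n / Y) + Real.log (Y / j) := by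
    rw [← Real.log_mul (by positivity) (by positivity)]
    congr 1
    field_simp
  have h3 : (j : ℝ) * Real.log (Y / j) ≤ Y - j := by
    have := Real.log_le_sub_one_of_pos (show 0 < Y / j by positivity)
    calc (j : ℝ) * Real.log (Y / j) ≤ j * (Y / j - 1) := mul_le_mul_of_nonneg_left this hj0.le
      _ = Y - j := by field_simp
  have h4 : (j : ℝ) * Real.log (n / Y) ≤ Y * Real.log (n / Y) := by
    refine mul_le_mul_of_nonneg_right hjY (Real.log_nonneg ?_)
    rw [le_div_iff₀ hY0, one_mul]; exact hYn
  calc Real.log (n.choose j : ℝ) ≤ j * (1 + Real.log (n / j)) := h1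
    _ = j + (j * Real.log (n / Y) + j * Real.log (Y / j)) := by rw [h2]; ring
    _ ≤ j + (Y * Real.log (n / Y) + (Y - j)) := by linarith
    _ = Y * (1 + Real.log (n / Y)) := by ring

/-- **The choice of `δ`** (Aizenman–Duminil-Copin 2021, end of the proof of Prop. 4.3:
"`P[𝐌_0 < δK] ≤ binom(K/2, δK)(1-c₀)^{(½-δ)K}`, which implies the claim by appropriately choosing the
value of `δ`"): for every `0 < q < 1` there is `δ ∈ (0, 1/16]` such that
`binom(n, j) q^{n-j} ≤ e^{-δK}` for all naturals `K ≥ 8`, `K/2 - 2 ≤ n ≤ K` and `j ≤ δK`. One may take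
`δ = (L/(4(4+L)))²`, `L = -log q`. [cite: AizenmanDuminilCopinAnnals2021, arXiv:1912.07973 §4.2, proof of Prop. 4.3 (last display, p. 15)] -/
theorem exists_delta_choose_mul_pow_le_exp_neg {q : ℝ} (hq0 : 0 < q) (hq1 : q < 1) :
    ∃ δ : ℝ, 0 < δ ∧ δ ≤ 1 / 16 ∧ ∀ K n j : ℕ, 8 ≤ K → (K : ℝ) / 2 - 2 ≤ n → n ≤ K →
      (j : ℝ) ≤ δ * K → (n.choose j : ℝ) * q ^ (n - j) ≤ Real.exp (-(δ * K)) := by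
  -- the constants
  set L : ℝ := - Real.log q with hL
  have hL0 : 0 < L := by rw [hL]; exact neg_pos.2 (Real.log_neg hq0 hq1)
  set s : ℝ := L / (4 * (4 + L)) with hs
  have hs0 : 0 < s := by positivity
  have hs4 : s < 1 / 4 := by
    rw [hs, div_lt_iff₀ (by positivity)]; nlinarith
  set δ : ℝ := s ^ 2 with hδ
  have hδ0 : 0 < δ := by positivity
  have hδs : δ ≤ s := by rw [hδ]; nlinarith
  have hδ16 : δ ≤ 1 / 16 := by rw [hδ]; nlinarith
  have hδ1 : δ < 1 := by linarith
  -- `-δ log δ ≤ 2s`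
  have hlogδ : -(δ * Real.log δ) ≤ 2 * s := by
    have hls : -(s * Real.log s) ≤ 1 := by
      have h := Real.log_le_sub_one_of_pos (show 0 < 1 / s by positivity)
      rw [one_div, Real.log_inv] at h
      have : s * (-Real.log s) ≤ s * (s⁻¹ - 1) := mul_le_mul_of_nonneg_left h hs0.le
      rw [mul_sub, mul_inv_cancel₀ hs0.ne'] at this
      nlinarith
    have : Real.log δ = 2 * Real.log s := by rw [hδ, Real.log_pow]; norm_num
    rw [this]
    nlinarith
  -- `Φ(δ) = δ(2 - log δ) + δ L ≤ L/4` (the coefficient of `K`)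
  have hΦ : δ * (2 - Real.log δ) + δ * L ≤ L / 4 := by
    have h1 : δ * L ≤ s * L := mul_le_mul_of_nonneg_right hδs hL0.le
    have h2 : s * (4 + L) = L / 4 := by rw [hs]; field_simp
    linarith
  refine ⟨δ, hδ0, hδ16, ?_⟩
  intro K n j hK hKn hnK hjδ
  have hK8 : (8 : ℝ) ≤ K := by exact_mod_cast hK
  set Y : ℝ := δ * K with hY
  have hY0 : 0 < Y := by positivity
  have hYn : Y ≤ n := by
    have : Y ≤ (K : ℝ) / 16 := by rw [hY]; nlinarith
    linarith
  have hjn : j ≤ n := by exact_mod_cast (hjδ.trans hYn)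
  have hchoose_pos : (0 : ℝ) < (n.choose j : ℝ) := by exact_mod_cast Nat.choose_pos hjn
  have hqpow : 0 < q ^ (n - j) := pow_pos hq0 _
  -- `log binom(n,j) ≤ Y (1 - log δ)`
  have hlogC : Real.log (n.choose j : ℝ) ≤ Y * (1 - Real.log δ) := by
    rcases Nat.eq_zero_or_pos j with hj0 | hjpos
    · subst hj0
      simp only [Nat.choose_zero_right, Nat.cast_one, Real.log_one]
      have : Real.log δ ≤ 0 := Real.log_nonpos hδ0.le hδ1.le
      nlinarith
    · have h := log_choose_le (n := n) hjpos hjδ hYn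
      have hn0 : (0 : ℝ) < n := lt_of_lt_of_le hY0 hYn
      have hnY : Real.log (n / Y) ≤ - Real.log δ := by
        have : (n : ℝ) / Y ≤ δ⁻¹ := by
          rw [hY, div_le_iff₀ hY0]
          calc (n : ℝ) ≤ K := by exact_mod_cast hnK
            _ = δ⁻¹ * (δ * K) := by field_simp
        calc Real.log (n / Y) ≤ Real.log δ⁻¹ := Real.log_le_log (by positivity) this
          _ = - Real.log δ := Real.log_inv δ
      calc Real.log (n.choose j : ℝ) ≤ Y * (1 + Real.log (n / Y)) := h
        _ ≤ Y * (1 - Real.log δ) := by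
            refine mul_le_mul_of_nonneg_left ?_ hY0.le
            linarith
  -- `log q^{n-j} = -(n-j) L ≤ -(n - Y) L`
  have hlogq : Real.log (q ^ (n - j)) ≤ -((n : ℝ) - Y) * L := by
    rw [Real.log_pow, Nat.cast_sub hjn, hL]
    have : ((n : ℝ) - Y) ≤ (n : ℝ) - j := by linarith
    nlinarith [Real.log_neg hq0 hq1]
  -- add up
  have hsum : Real.log ((n.choose j : ℝ) * q ^ (n - j)) ≤ -Y := by
    rw [Real.log_mul hchoose_pos.ne' hqpow.ne']
    have hK' : (K : ℝ) * (δ * (1 - Real.log δ) + δ * L - L / 2) + 2 * L ≤ -(δ * K) := by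
      have h1 := mul_le_mul_of_nonneg_left hΦ (by positivity : (0 : ℝ) ≤ K)
      have hKL : 8 * L ≤ (K : ℝ) * L := mul_le_mul_of_nonneg_right hK8 hL0.le
      linarith
    calc Real.log (n.choose j : ℝ) + Real.log (q ^ (n - j))
        ≤ Y * (1 - Real.log δ) + (-((n : ℝ) - Y) * L) := add_le_add hlogC hlogq
      _ ≤ Y * (1 - Real.log δ) + (-((K : ℝ) / 2 - 2 - Y) * L) := by nlinarith
      _ = (K : ℝ) * (δ * (1 - Real.log δ) + δ * L - L / 2) + 2 * L := by rw [hY]; ring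
      _ ≤ -Y := by rw [hY]; exact hK'
  calc (n.choose j : ℝ) * q ^ (n - j) = Real.exp (Real.log ((n.choose j : ℝ) * q ^ (n - j))) := by
        rw [Real.exp_log (mul_pos hchoose_pos hqpow)]
    _ ≤ Real.exp (-(δ * K)) := Real.exp_le_exp.2 hsum

end Literature.Probability.LatticeModels
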